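import Literature.MathematicalPhysics.QuantumLattice.GaugeGroupsProofs
import Literature.Analysis.Convex.SymmetryAdaptedBlockDiagonalization
import HarnessLib

/-!
# The fundamental representation of `SU(N)` is irreducible and sees the centre

Companion proof file of `Literature/MathematicalPhysics/QuantumLattice/GaugeGroups.lean` (which defines
`fundamentalRep n : SU(n) →* M_n(ℂ)`) and `GaugeGroupsProofs.lean` (diagonal circles `dPairHom`, signed transpositions
`sSwap`, connectedness and simplicity of `SU(n)`); same namespace. It declares no definition and no named fact; it PROVES,
for `N ≥ 2`, the two representation-theoretic inputs under which the tree's lattice-gauge-theory facts stated for «a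
finite-dimensional irreducible unitary representation `π` that acts nontrivially on the center» (Chatterjee 2021 Thm 2.2 /
Thm 2.4: `chatterjee2021_confinement_of_centreUnbroken`, `chatterjee2021_areaLaw_of_strongExpDecay` in
`CentreSymmetry.lean`) apply to the FUNDAMENTAL Wilson loop of `SU(N)`:

* `isIrrep_fundamentalRep` — the defining representation of `SU(N)` on `ℂ^N` is irreducible in the tree's matrix sense
  `Literature.Analysis.Convex.SymmetryAdapted.IsIrrep` (= Mathlib's `Representation.IsIrreducible` of the attached linear
  representation). Elementary proof avoiding Lie theory: an invariant subspace containing `v` with `v_k ≠ 0` contains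
  `v − D_{kl}(−1)v = 2(v_k e_k + v_l e_l)` and then `u − i·D_{kl}(i)u = 4 v_k e_k` (diagonal circles of
  `GaugeGroupsProofs`), hence `e_k`, hence every `e_j = −sSwap(j,k)·e_k`, hence everything
  (Bröcker–tom Dieck 1985, II §5: the standard representation `Λ¹` of `SU(n)` is irreducible; Sepanski 2007 §2.1.1).
* `exists_center_fundamentalRep_ne_one` — `ω·1 ∈ Z(SU(N))` for the primitive root `ω = e^{2πi/N}` and the fundamental
  representation maps it to `ω·1 ≠ 1` («acts nontrivially on the center», Chatterjee 2021 §2.3; the centre of `SU(n)` is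
  the group of `n`-th roots of unity, Bröcker–tom Dieck 1985, IV (3.10)). Only the easy inclusion `μ_N·1 ⊆ Z(SU(N))` is
  used and proved.

First consumer: `Summits/QuantumFields/YangMills/Theorems/WeakCouplingMasslessPhaseDeconfinedIsMasslessNotPerimeterOfCentreUnbroken.lean`
(which carries private copies of both lemmas, landed before this file; new users should import this one).

## References

* T. Bröcker, T. tom Dieck, *Representations of Compact Lie Groups*, GTM 98 (1985), II §5 (representations of `SU(n)`),
  IV (3.10) (centre of `SU(n)`). [BrockerTomDieck1985]
* M. Sepanski, *Compact Lie Groups* (2007), §2.1.1 (standard representations). [Sepanski2007]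
* S. Chatterjee, *A probabilistic mechanism for quark confinement*, CMP 385 (2021), §2.3 («`π` acts nontrivially on the
  center»). [Chatterjee2021]
-/

set_option autoImplicit false

noncomputable section

namespace Literature.MathematicalPhysics.QuantumLattice

open Literature.Analysis.Convex

section Irrep

variable {N : ℕ}

/-- The diagonal circle `D_{kl}(w) = diag(…, w (at k), …, w⁻¹ (at l), …) ∈ SU(N)` acts on `ℂ^N` coordinatewise:
`(D v)_x = pairFun k l w x · v_x`. [folklore] -/
private theorem dPairHom_mulVec (k l : Fin N) (w : Circle) (v : Fin N → ℂ) (x : Fin N) :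
    ((dPairHom k l w : Matrix.specialUnitaryGroup (Fin N) ℂ) : Matrix (Fin N) (Fin N) ℂ).mulVec v x =
      pairFun k l (w : ℂ) x * v x := by
  rw [coe_dPairHom, Matrix.mulVec_diagonal]

/-- The signed transposition `sSwap j k ∈ SU(N)` (`j ≠ k`) maps the coordinate vector `e_k` to `−e_j`. [folklore] -/
private theorem sSwap_mulVec_single {j k : Fin N} (hjk : j ≠ k) :
    ((sSwap j k : Matrix.specialUnitaryGroup (Fin N) ℂ) : Matrix (Fin N) (Fin N) ℂ).mulVec (Pi.single k 1) =
      -(Pi.single j (1 : ℂ)) := by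
  rw [coe_sSwap, sSwapMatrix, if_neg hjk, ← Matrix.mulVec_mulVec, Matrix.swap_mulVec]
  have hcomp : (Pi.single k (1 : ℂ) : Fin N → ℂ) ∘ Equiv.swap j k = Pi.single j 1 := by
    funext x
    simp only [Function.comp_apply]
    by_cases hxj : x = j
    · subst hxj; simp
    · by_cases hxk : x = k
      · subst hxk
        rw [Equiv.swap_apply_right, Pi.single_eq_of_ne hjk, Pi.single_eq_of_ne (Ne.symm hjk)]
      · rw [Equiv.swap_apply_of_ne_of_ne hxj hxk, Pi.single_eq_of_ne hxk, Pi.single_eq_of_ne hxj]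
  rw [hcomp]
  funext x
  rw [Matrix.mulVec_diagonal, Pi.neg_apply]
  by_cases hxj : x = j
  · subst hxj; simp
  · simp [Pi.single_eq_of_ne hxj]

/-- **The defining representation of `SU(N)` on `ℂ^N` is irreducible** (`N ≥ 2`): a non-zero `SU(N)`-invariant
subspace `W ∋ v`, `v_k ≠ 0`, contains `v − D_{kl}(−1)v = 2(v_k e_k + v_l e_l)`, then
`u − i·D_{kl}(i)u = 4 v_k e_k`, hence `e_k`, hence every `e_j = −sSwap(j,k) e_k`, hence everything
(Bröcker–tom Dieck 1985, II §5: the standard representation of `SU(n)` is irreducible; elementary matrix proof).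
[cite: BrockerTomDieck1985, II §5] -/
theorem isIrrep_fundamentalRep (hN : 2 ≤ N) : SymmetryAdapted.IsIrrep (fundamentalRep (Fin N)) := by
  classical
  haveI : Nontrivial (Fin N) := Fin.nontrivial_iff_two_le.2 hN
  rw [SymmetryAdapted.isIrrep_iff]
  refine ⟨inferInstance, fun W hW => ?_⟩
  by_cases hbot : W = ⊥
  · exact Or.inl hbot
  right
  obtain ⟨v, hvW, hv0⟩ := (Submodule.ne_bot_iff W).1 hbot
  obtain ⟨k, hk⟩ : ∃ k, v k ≠ 0 := Function.ne_iff.1 hv0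
  obtain ⟨l, hlk⟩ := exists_ne k
  have hW' : ∀ (g : Matrix.specialUnitaryGroup (Fin N) ℂ) (u : Fin N → ℂ), u ∈ W →
      (g : Matrix (Fin N) (Fin N) ℂ).mulVec u ∈ W := fun g u hu => by
    simpa only [fundamentalRep_apply] using hW g u hu
  -- Step A: `e_k ∈ W`
  set m1 : Circle := circleOfNormEqOne (-1) (by simp) with hm1
  set cI : Circle := circleOfNormEqOne Complex.I (by simp) with hcI
  set u : Fin N → ℂ :=
    v - ((dPairHom k l m1 : Matrix.specialUnitaryGroup (Fin N) ℂ) : Matrix (Fin N) (Fin N) ℂ).mulVec v with hu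
  have huW : u ∈ W := W.sub_mem hvW (hW' _ v hvW)
  set t : Fin N → ℂ :=
    u - Complex.I • ((dPairHom k l cI : Matrix.specialUnitaryGroup (Fin N) ℂ) : Matrix (Fin N) (Fin N) ℂ).mulVec u
    with ht
  have htW : t ∈ W := W.sub_mem huW (W.smul_mem _ (hW' _ u huW))
  have ht_eq : t = (4 * v k) • (Pi.single k (1 : ℂ) : Fin N → ℂ) := by
    funext x
    simp only [ht, hu, Pi.sub_apply, Pi.smul_apply, smul_eq_mul, dPairHom_mulVec, hm1, hcI,
      coe_circleOfNormEqOne, pairFun, Pi.mul_apply, Pi.mulSingle_apply]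
    by_cases hxk : x = k
    · subst hxk
      simp only [if_true, if_neg (Ne.symm hlk), Pi.single_eq_same, mul_one]
      have hI : Complex.I * Complex.I = -1 := Complex.I_mul_I
      linear_combination (-(v x + v x)) * hI
    · by_cases hxl : x = l
      · subst hxl
        simp only [if_neg hxk, if_true, Pi.single_eq_of_ne hxk, mul_zero, one_mul, inv_neg, inv_one,
          Complex.inv_I]
        have hI : Complex.I * Complex.I = -1 := Complex.I_mul_I
        linear_combination (v x + v x) * hI
      · simp [if_neg hxk, if_neg hxl, Pi.single_eq_of_ne hxk]
  have hek : (Pi.single k (1 : ℂ) : Fin N → ℂ) ∈ W := by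
    have h4 : (4 * v k : ℂ) ≠ 0 := mul_ne_zero (by norm_num) hk
    have : (4 * v k)⁻¹ • t ∈ W := W.smul_mem _ htW
    rwa [ht_eq, smul_smul, inv_mul_cancel₀ h4, one_smul] at this
  -- Step B: every `e_j ∈ W`
  have hej : ∀ j : Fin N, (Pi.single j (1 : ℂ) : Fin N → ℂ) ∈ W := by
    intro j
    by_cases hjk : j = k
    · subst hjk; exact hek
    · have h := hW' (sSwap j k) _ hek
      rw [sSwap_mulVec_single hjk] at h
      simpa using W.neg_mem h
  -- conclusion
  rw [eq_top_iff]
  rintro x -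
  rw [pi_eq_sum_univ' x]
  exact W.sum_mem fun j _ => W.smul_mem _ (hej j)

/-- A non-trivial central element of `SU(N)`, `N ≥ 2`, on which the fundamental representation is the scalar
`ω = e^{2πi/N} ≠ 1`: `ω·1 ∈ Z(SU(N))` and `π(ω·1) ≠ 1` («`π` acts nontrivially on the center», Chatterjee 2021
§2.3; `μ_N·1 ⊆ Z(SU(N))`, Bröcker–tom Dieck 1985, IV (3.10)). [cite: BrockerTomDieck1985, IV (3.10)] -/
theorem exists_center_fundamentalRep_ne_one (hN : 2 ≤ N) :
    ∃ g₀ ∈ Subgroup.center (Matrix.specialUnitaryGroup (Fin N) ℂ), fundamentalRep (Fin N) g₀ ≠ 1 := by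
  classical
  have hN0 : N ≠ 0 := by omega
  set ω : ℂ := Complex.exp (2 * Real.pi * Complex.I / N) with hω
  have hprim : IsPrimitiveRoot ω N := Complex.isPrimitiveRoot_exp N hN0
  have hω1 : ‖ω‖ = 1 := hprim.norm'_eq_one hN0
  have hωN : ω ^ N = 1 := hprim.pow_eq_one
  have hωne : ω ≠ 1 := hprim.ne_one (by omega)
  have hmem : Matrix.diagonal (fun _ : Fin N => ω) ∈ Matrix.specialUnitaryGroup (Fin N) ℂ := by
    rw [diagonal_mem_specialUnitaryGroup_iff]
    exact ⟨fun _ => hω1, by simp [hωN]⟩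
  refine ⟨⟨Matrix.diagonal fun _ => ω, hmem⟩, ?_, ?_⟩
  · rw [Subgroup.mem_center_iff]
    intro g
    apply Subtype.ext
    change (g : Matrix (Fin N) (Fin N) ℂ) * Matrix.diagonal (fun _ => ω) =
      Matrix.diagonal (fun _ => ω) * (g : Matrix (Fin N) (Fin N) ℂ)
    rw [← Matrix.smul_one_eq_diagonal, mul_smul_comm, smul_mul_assoc, mul_one, one_mul]
  · intro h
    apply hωne
    have h00 := congrFun (congrFun h ⟨0, by omega⟩) ⟨0, by omega⟩
    simpa [fundamentalRep_apply] using h00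

end Irrep

end Literature.MathematicalPhysics.QuantumLattice

end
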